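import Summits.AtomisticToContinuum.HydrodynamicLimit.Theses.AntiMazurCoboundaries
import Literature.Analysis.FluidPDE.HardSphereEuclideanAlexander
import Literature.Analysis.FluidPDE.BoltzmannGradLimitProofs
import Literature.Analysis.FluidPDE.BBGKYMarginalsPartitionProofs

/-!
# `CellForecastPressureDecay`: the cell Gibbs law is a probability measure, and the crux is false
# without its orthogonality hypothesis (load-bearing analysis, dynamics-free)

Negative knowledge for the crux `AntiMazurCoboundaries.CellForecastPressureDecay`
(stmt-AtomisticToContinuum-13915), from the standing disprover's
`Cruxes/CellForecastPressureDecay/Disproof.lean` (seat refuter-cdisprove-stmt-AtomisticToContinuum-13915-0).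
Unconditional: the Euclidean Alexander theorem `HardSphereFlow.nonempty_holds` is PROVED in the tree, so the
crux's `∀ Ψ` can be instantiated.

* § 1 (infrastructure the provers need as well): the canonical cell law
  `particleLaw (Ψ n) (canonicalDensity (Euclidean.geometry (Fin 3)) σ n (1_{[0,L]³} ⊗ M))` of the crux is a
  PROBABILITY measure for `σ ≤ 3/16`, `1 ≤ L`, `n ≤ 2L³` (`isProbabilityMeasure_cellLaw`; positivity of the
  partition function by an explicit grid of admissible configurations, `canonicalPartition_cell_pos`).
* § 2: `CellForecastPressureDecayWithoutOrthogonality` — the crux VERBATIM with the hypothesis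
  `∀ c₀ c₂ b, ∫ g (c₀ + ⟪b,v⟫ + c₂‖v‖²) dγ = 0` deleted — is FALSE
  (`cellForecastPressureDecay_false_without_orthogonality`, witness `g ≡ κ`: the window average of a
  constant along ANY forecast is the constant; `δ = κ`, `L = max L₀ 2`, `n = ⌊L³⌋`, `c = 1`). Hence any proof
  of the crux must use `g ⊥ 1`; no dynamics is involved.

Companion files: `Negative/LoneParticle.lean` (the `n = 1` model: a 1-cluster forecast is free flight, the
functional is `∫ M e^{2cg}`), `Negative/PerParticle.lean` (the per-volume slack is load-bearing).
-/

open MeasureTheory Set Metric Filter ProbabilityTheory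
open scoped ENNReal InnerProductSpace
open Literature.Analysis.FluidPDE Literature.MathematicalPhysics.KineticTheory

namespace Summit.AtomisticToContinuum.HydrodynamicLimit.Theorems

noncomputable section

namespace CellForecastPressureDecay

/-! ## § 1 The cell Gibbs law is a probability measure -/

/-- The confining cube `[0,L]^3` of the crux. -/
def cellCube (L : ℝ) : Set V3 := {x : V3 | ∀ k, x k ∈ Set.Icc (0 : ℝ) L}

/-- The one-particle reference density of the crux: `1_{[0,L]^3}(x) · M(v)`. -/
def cellRef (L : ℝ) (p : V3 × V3) : ℝ :=
  Set.indicator {x : V3 | ∀ k, x k ∈ Set.Icc (0 : ℝ) L} (fun _ => (1 : ℝ)) p.1 * globalMaxwellian p.2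

/-- `cellRef L` is literally the reference density written in the crux. [folklore] -/
theorem cellRef_eq (L : ℝ) : cellRef L = fun p : V3 × V3 =>
    Set.indicator {x : V3 | ∀ k, x k ∈ Set.Icc (0 : ℝ) L} (fun _ => (1 : ℝ)) p.1 *
      globalMaxwellian p.2 := rfl

/-- The cube is the preimage of the order-interval `[0, L]^3 ⊂ (Fin 3 → ℝ)` under `ofLp`. [folklore] -/
theorem cellCube_eq_preimage (L : ℝ) :
    cellCube L = (WithLp.ofLp : V3 → (Fin 3 → ℝ)) ⁻¹' Set.Icc (0 : Fin 3 → ℝ) (fun _ => L) := by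
  ext x
  simp only [cellCube, mem_setOf_eq, mem_Icc, mem_preimage, Pi.le_def, Pi.zero_apply]
  exact ⟨fun h => ⟨fun k => (h k).1, fun k => (h k).2⟩, fun h k => ⟨h.1 k, h.2 k⟩⟩

/-- The cube is measurable. [folklore] -/
theorem measurableSet_cellCube (L : ℝ) : MeasurableSet (cellCube L) := by
  rw [cellCube_eq_preimage]
  exact measurableSet_Icc.preimage (PiLp.volume_preserving_ofLp (Fin 3)).measurable

/-- The cube has volume `L³` (`ofLp` is volume preserving on `EuclideanSpace`). [folklore] -/
theorem volume_cellCube (L : ℝ) : volume (cellCube L) = ENNReal.ofReal L ^ 3 := by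
  rw [cellCube_eq_preimage, (PiLp.volume_preserving_ofLp (Fin 3)).measure_preimage
      measurableSet_Icc.nullMeasurableSet, Real.volume_Icc_pi]
  simp

/-- The reference density is nonnegative. [folklore] -/
theorem cellRef_nonneg (L : ℝ) : 0 ≤ cellRef L := fun p =>
  mul_nonneg (Set.indicator_nonneg (fun _ _ => zero_le_one) _) (globalMaxwellian_pos p.2).le

/-- The reference density `1_{[0,L]^3} ⊗ M` is integrable on `ℝ³ × ℝ³`. [folklore] -/
theorem integrable_cellRef (L : ℝ) : Integrable (cellRef L) := by
  have h1 : Integrable (fun x : V3 => (cellCube L).indicator (fun _ => (1 : ℝ)) x) := by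
    rw [integrable_indicator_iff (measurableSet_cellCube L)]
    refine integrableOn_const ?_
    rw [volume_cellCube]
    exact (ENNReal.pow_lt_top ENNReal.ofReal_lt_top).ne
  have h2 : Integrable (globalMaxwellian (E := V3)) := integrable_globalMaxwellian
  have h := h1.mul_prod h2
  rw [← Measure.volume_eq_prod] at h
  exact h

/-- A grid of `n ≤ 2L³` well-separated points inside `[1/8, L - 1/8]^3` (spacing `1/4`). [folklore] -/
theorem exists_grid {L : ℝ} (hL : 1 ≤ L) {n : ℕ} (hn : (n : ℝ) ≤ 2 * L ^ 3) :
    ∃ c : Fin n → V3, (∀ i k, 1 / 8 ≤ c i k ∧ c i k ≤ L - 1 / 8) ∧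
      ∀ i j, i ≠ j → ∃ k, 1 / 4 ≤ |c i k - c j k| := by
  set m := ⌊L⌋₊ with hm
  have hm1 : 1 ≤ m := Nat.le_floor (by exact_mod_cast hL)
  have hm1' : (1 : ℝ) ≤ m := by exact_mod_cast hm1
  have hLm : L < m + 1 := Nat.lt_floor_add_one L
  have hmL : (m : ℝ) ≤ L := Nat.floor_le (by linarith)
  set M := 4 * m with hM
  have hcard : n ≤ Fintype.card (Fin 3 → Fin M) := by
    classical
    rw [Fintype.card_fun, Fintype.card_fin, Fintype.card_fin]
    have h0 : (0 : ℝ) ≤ L := by linarith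
    have : (n : ℝ) < (M : ℝ) ^ 3 := by
      calc (n : ℝ) ≤ 2 * L ^ 3 := hn
        _ < 2 * ((m : ℝ) + 1) ^ 3 := by gcongr
        _ ≤ 2 * (2 * (m : ℝ)) ^ 3 := by gcongr; linarith
        _ = 16 * (m : ℝ) ^ 3 := by ring
        _ ≤ 64 * (m : ℝ) ^ 3 := by nlinarith [pow_nonneg (zero_le_one.trans hm1') 3]
        _ = (M : ℝ) ^ 3 := by rw [hM]; push_cast; ring
    exact_mod_cast this.le
  let ι : Fin n → (Fin 3 → Fin M) := fun i =>
    (Fintype.equivFin (Fin 3 → Fin M)).symm (Fin.castLE hcard i)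
  have hι : Function.Injective ι :=
    (Equiv.injective _).comp (Fin.castLE_injective hcard)
  refine ⟨fun i => WithLp.toLp 2 fun k => ((ι i k : ℕ) : ℝ) / 4 + 1 / 8, ?_, ?_⟩
  · intro i k
    dsimp only
    have hq : ((ι i k : ℕ) : ℝ) + 1 ≤ M := by exact_mod_cast (ι i k).isLt
    have hq0 : (0 : ℝ) ≤ ((ι i k : ℕ) : ℝ) := Nat.cast_nonneg _
    have hM' : (M : ℝ) = 4 * m := by rw [hM]; push_cast; ring
    constructor
    · linarith
    · rw [hM'] at hq
      linarith
  · intro i j hij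
    have hne : ι i ≠ ι j := fun h => hij (hι h)
    obtain ⟨k, hk⟩ := Function.ne_iff.1 hne
    refine ⟨k, ?_⟩
    dsimp only
    have hk' : (ι i k : ℕ) ≠ (ι j k : ℕ) := fun h => hk (Fin.ext h)
    have h1 : (1 : ℝ) ≤ |((ι i k : ℕ) : ℝ) - ((ι j k : ℕ) : ℝ)| := by
      rcases lt_or_gt_of_ne hk' with h | h
      · have : ((ι i k : ℕ) : ℝ) + 1 ≤ ((ι j k : ℕ) : ℝ) := by exact_mod_cast h
        rw [abs_sub_comm, abs_of_nonneg (by linarith)]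
        linarith
      · have : ((ι j k : ℕ) : ℝ) + 1 ≤ ((ι i k : ℕ) : ℝ) := by exact_mod_cast h
        rw [abs_of_nonneg (by linarith)]
        linarith
    have : ((ι i k : ℕ) : ℝ) / 4 + 1 / 8 - (((ι j k : ℕ) : ℝ) / 4 + 1 / 8) =
        (((ι i k : ℕ) : ℝ) - ((ι j k : ℕ) : ℝ)) / 4 := by ring
    rw [this, abs_div, abs_of_pos (by norm_num : (0 : ℝ) < 4)]
    linarith

/-- Coordinates are `1`-Lipschitz on `V3 = ℝ³` (Euclidean norm). [folklore] -/
theorem abs_apply_sub_apply_le (x y : V3) (k : Fin 3) : |x k - y k| ≤ ‖x - y‖ := by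
  have h := PiLp.norm_apply_le (x - y) k
  rwa [PiLp.sub_apply, Real.norm_eq_abs] at h

/-- **Positivity of the cell partition function**: for `0 ≤ σ ≤ 3/16`, `L ≥ 1` and `n ≤ 2L³`
the canonical partition function of `n` spheres of diameter `σ` in `[0,L]^3` with Maxwellian
velocities is positive (explicit grid of admissible configurations). [folklore] -/
theorem canonicalPartition_cell_pos {σ L : ℝ} (hσ' : σ ≤ 3 / 16) (hL : 1 ≤ L)
    {n : ℕ} (hn : (n : ℝ) ≤ 2 * L ^ 3) :
    0 < canonicalPartition (Euclidean.geometry (Fin 3)) σ n (cellRef L) := by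
  obtain ⟨c, hc_in, hc_sep⟩ := exists_grid hL hn
  set A : Set (Config n (Fin 3) V3) :=
    Set.univ.pi fun i => ball (c i) (1 / 32) ×ˢ ball (0 : V3) 1 with hA
  have hAm : MeasurableSet A :=
    MeasurableSet.univ_pi fun i => measurableSet_ball.prod measurableSet_ball
  have hvolA : volume A =
      ∏ i : Fin n, volume (ball (c i) (1 / 32 : ℝ)) * volume (ball (0 : V3) (1 : ℝ)) := by
    rw [hA, volume_pi, Measure.pi_pi]
    congr 1
    funext i
    rw [Measure.volume_eq_prod, Measure.prod_prod]
  have hvolA_pos : 0 < volume A := by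
    rw [hvolA]
    exact pos_iff_ne_zero.2 (Finset.prod_ne_zero_iff.2 fun i _ =>
      mul_ne_zero (measure_ball_pos volume _ (by norm_num)).ne' (measure_ball_pos volume _ one_pos).ne')
  have hvolA_lt : volume A < ⊤ := by
    rw [hvolA]
    exact ENNReal.prod_lt_top fun i _ => ENNReal.mul_lt_top measure_ball_lt_top measure_ball_lt_top
  -- Maxwellian floor on the unit ball
  set e : V3 := EuclideanSpace.single 0 1 with he
  set μ₀ : ℝ := globalMaxwellian e with hμ₀def
  have hμ₀ : 0 < μ₀ := globalMaxwellian_pos e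
  have hfloor : ∀ v : V3, ‖v‖ < 1 → μ₀ ≤ globalMaxwellian v := by
    intro v hv
    have hne : ‖e‖ = 1 := by
      rw [he, EuclideanSpace.single, PiLp.norm_single, norm_one]
    simp only [hμ₀def, globalMaxwellian]
    refine mul_le_mul_of_nonneg_left (Real.exp_le_exp.2 ?_) (by positivity)
    rw [hne]
    have : ‖v‖ ^ 2 ≤ 1 := by nlinarith [norm_nonneg v]
    linarith
  -- pointwise lower bound
  have hpt : ∀ z, A.indicator (fun _ => μ₀ ^ n) z ≤
      (hardSphereDomain (Euclidean.geometry (Fin 3)) n σ).indicator (tensorPow n (cellRef L)) z := by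
    intro z
    by_cases hz : z ∈ A
    · have hz' : ∀ i, dist (z i).1 (c i) < 1 / 32 ∧ ‖(z i).2‖ < 1 := by
        intro i
        have := (Set.mem_univ_pi.1 hz) i
        rw [Set.mem_prod, mem_ball, mem_ball_zero_iff] at this
        exact this
      have hcoord : ∀ i k, |(z i).1 k - c i k| < 1 / 32 := fun i k =>
        (abs_apply_sub_apply_le _ _ k).trans_lt (by rw [← dist_eq_norm]; exact (hz' i).1)
      have hzD : z ∈ hardSphereDomain (Euclidean.geometry (Fin 3)) n σ := by
        rw [mem_hardSphereDomain]
        intro i j hij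
        obtain ⟨k, hk⟩ := hc_sep i j hij
        rw [Euclidean.geometry_sepVec]
        have h1 := hcoord i k
        have h2 := hcoord j k
        have h3 := abs_apply_sub_apply_le (z i).1 (z j).1 k
        have h4 : 3 / 16 ≤ |(z i).1 k - (z j).1 k| := by
          have := abs_sub_abs_le_abs_sub (c i k - c j k) ((c i k - (z i).1 k) - (c j k - (z j).1 k))
          have h5 : c i k - c j k - (c i k - (z i).1 k - (c j k - (z j).1 k)) = (z i).1 k - (z j).1 k := by ring
          rw [h5] at this
          have h6 := abs_sub (c i k - (z i).1 k) (c j k - (z j).1 k)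
          rw [abs_sub_comm (c i k)] at h6
          rw [abs_sub_comm (c j k)] at h6
          linarith
        linarith
      rw [indicator_of_mem hz, indicator_of_mem hzD, tensorPow]
      have hfac : ∀ i, μ₀ ≤ cellRef L (z i) := by
        intro i
        have hxin : (z i).1 ∈ {x : V3 | ∀ k, x k ∈ Set.Icc (0 : ℝ) L} := by
          intro k
          have h1 := hcoord i k
          have h2 := hc_in i k
          rw [abs_lt] at h1
          constructor <;> linarith [h2.1, h2.2]
        simp only [cellRef, indicator_of_mem hxin, one_mul]
        exact hfloor _ (hz' i).2
      calc μ₀ ^ n = ∏ _i : Fin n, μ₀ := by simp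
        _ ≤ ∏ i, cellRef L (z i) := Finset.prod_le_prod (fun i _ => hμ₀.le) fun i _ => hfac i
    · rw [indicator_of_notMem hz]
      exact Set.indicator_nonneg (fun w _ => tensorPow_nonneg (cellRef_nonneg L) n w) _
  have hint : Integrable ((hardSphereDomain (Euclidean.geometry (Fin 3)) n σ).indicator
      (tensorPow n (cellRef L))) :=
    (integrable_tensorPow n (integrable_cellRef L)).indicator
      (measurableSet_hardSphereDomain _ Euclidean.measurable_geometry_sepVec n σ)
  have hintA : Integrable (A.indicator fun _ : Config n (Fin 3) V3 => μ₀ ^ n) := by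
    rw [integrable_indicator_iff hAm]
    exact integrableOn_const hvolA_lt.ne
  calc 0 < (volume A).toReal * μ₀ ^ n :=
        mul_pos (ENNReal.toReal_pos hvolA_pos.ne' hvolA_lt.ne) (pow_pos hμ₀ n)
    _ = ∫ z, A.indicator (fun _ => μ₀ ^ n) z := by
        rw [integral_indicator_const _ hAm, smul_eq_mul, Measure.real]
    _ ≤ canonicalPartition (Euclidean.geometry (Fin 3)) σ n (cellRef L) :=
        integral_mono hintA hint hpt

/-- **The cell Gibbs law of the crux is a probability measure** for `0 ≤ σ ≤ 3/16`, `L ≥ 1`,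
`n ≤ 2L³`, whatever the hard-sphere flow parameter. [folklore] -/
theorem isProbabilityMeasure_cellLaw {σ L : ℝ} (hσ' : σ ≤ 3 / 16) (hL : 1 ≤ L)
    {n : ℕ} (hn : (n : ℝ) ≤ 2 * L ^ 3) (Φ : HardSphereFlow (Euclidean.geometry (Fin 3)) σ n) :
    IsProbabilityMeasure (particleLaw Φ
      (canonicalDensity (Euclidean.geometry (Fin 3)) σ n (cellRef L))) := by
  have hZ := canonicalPartition_cell_pos hσ' hL hn
  refine isProbabilityMeasure_particleLaw Φ ?_ ?_ (integral_canonicalDensity _ _ _ _ hZ.ne')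
  · intro z
    simp only [canonicalDensity, Pi.zero_apply]
    exact mul_nonneg (inv_nonneg.2 hZ.le)
      (Set.indicator_nonneg (fun w _ => tensorPow_nonneg (cellRef_nonneg L) n w) z)
  · intro z hz
    simp only [canonicalDensity]
    rw [indicator_of_notMem hz, mul_zero]

/-! ## § 2 Load-bearing hypothesis: orthogonality `g ⊥ span(1, v, |v|²)` -/

/-- `CellForecastPressureDecay` with the orthogonality hypothesis
`∀ c₀ c₂ b, ∫ g · (c₀ + ⟪b, v⟫ + c₂‖v‖²) dγ = 0` DROPPED (everything else byte-identical). -/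
def CellForecastPressureDecayWithoutOrthogonality : Prop :=
  ∃ σ₀ : ℝ, 0 < σ₀ ∧ ∀ σ : ℝ, 0 < σ → σ < σ₀ → ∃ κ : ℝ, 0 < κ ∧ ∀ g : Literature.MathematicalPhysics.KineticTheory.V3 → ℝ, Continuous g → (∀ v, |g v| ≤ κ) → ∀ δ : ℝ, 0 < δ → ∃ T : ℝ, 0 < T ∧ ∃ R₀ : ℝ, 0 < R₀ ∧ ∀ R : ℝ, R₀ ≤ R → ∃ L₀ : ℝ, 0 < L₀ ∧ ∀ L : ℝ, L₀ ≤ L → ∀ n : ℕ, (n : ℝ) ≤ 2 * L ^ 3 → ∀ (Ψ : (k : ℕ) → Literature.Analysis.FluidPDE.HardSphereFlow (Literature.Analysis.FluidPDE.Euclidean.geometry (Fin 3)) σ k) (c : ℝ), |c| ≤ 1 → ∫⁻ z, ENNReal.ofReal (Real.exp (2 * c * ∑ i : Fin n, T⁻¹ * ∫ t in (0 : ℝ)..T, g (Literature.Analysis.FluidPDE.localClusterState Ψ R t z i).2)) ∂(Literature.Analysis.FluidPDE.particleLaw (Ψ n) (Literature.Analysis.FluidPDE.canonicalDensity (Literature.Analysis.FluidPDE.Euclidean.geometry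 (Fin 3)) σ n (fun p => Set.indicator {x : Literature.MathematicalPhysics.KineticTheory.V3 | ∀ k, x k ∈ Set.Icc (0 : ℝ) L} (fun _ => (1 : ℝ)) p.1 * Literature.Analysis.FluidPDE.globalMaxwellian p.2))) ≤ ENNReal.ofReal (Real.exp (δ * L ^ 3))

/-- **Any proof must use the orthogonality of `g` to the constants**: with `g ≡ κ` (continuous,
`|g| ≤ κ`, but `∫ g dγ = κ ≠ 0`) the time average of `g` along ANY forecast is `κ`, the integrand
is the constant `exp(2cnκ)`, the cell law is a probability measure, and for `n = ⌊L³⌋`, `c = 1`,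
`δ = κ` the bound `exp(2nκ) ≤ exp(κL³)` fails. No dynamics is used. [folklore] -/
theorem cellForecastPressureDecay_false_without_orthogonality :
    ¬ CellForecastPressureDecayWithoutOrthogonality := by
  rintro ⟨σ₀, hσ₀, h⟩
  set σ : ℝ := min (σ₀ / 2) (3 / 16) with hσdef
  have hσpos : 0 < σ := by positivity
  have hσlt : σ < σ₀ := (min_le_left _ _).trans_lt (by linarith)
  obtain ⟨κ, hκ, h⟩ := h σ hσpos hσlt
  obtain ⟨T, hT, R₀, hR₀, h⟩ :=
    h (fun _ => κ) continuous_const (fun v => by rw [abs_of_pos hκ]) κ hκ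
  obtain ⟨L₀, hL₀, h⟩ := h R₀ le_rfl
  set L : ℝ := max L₀ 2 with hLdef
  have hL2 : 2 ≤ L := le_max_right _ _
  set n : ℕ := ⌊L ^ 3⌋₊ with hndef
  have hnle : (n : ℝ) ≤ L ^ 3 := Nat.floor_le (by positivity)
  have hnlt : L ^ 3 < n + 1 := Nat.lt_floor_add_one _
  set Ψ : (k : ℕ) → HardSphereFlow (Euclidean.geometry (Fin 3)) σ k :=
    fun k => (HardSphereFlow.nonempty_holds hσpos k).some with hΨ
  have key := h L (le_max_left _ _) n (by linarith [pow_nonneg (by linarith : (0:ℝ) ≤ L) 3]) Ψ 1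
    (by simp)
  have hP : IsProbabilityMeasure (particleLaw (Ψ n) (canonicalDensity
      (Euclidean.geometry (Fin 3)) σ n (fun p : V3 × V3 =>
        Set.indicator {x : V3 | ∀ k, x k ∈ Set.Icc (0 : ℝ) L} (fun _ => (1 : ℝ)) p.1 *
          globalMaxwellian p.2))) :=
    isProbabilityMeasure_cellLaw (min_le_right _ _) (by linarith)
      (by linarith [pow_nonneg (by linarith : (0:ℝ) ≤ L) 3]) (Ψ n)
  simp only [intervalIntegral.integral_const, sub_zero, smul_eq_mul, Finset.sum_const,
    Finset.card_univ, Fintype.card_fin, nsmul_eq_mul, lintegral_const, measure_univ,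
    mul_one] at key
  rw [ENNReal.ofReal_le_ofReal_iff (by positivity), Real.exp_le_exp] at key
  -- key : 2 * 1 * (n * (T⁻¹ * (T * κ))) ≤ κ * L ^ 3
  rw [inv_mul_cancel_left₀ hT.ne'] at key
  have h8 : (8 : ℝ) ≤ L ^ 3 := by
    have h4 : (4 : ℝ) ≤ L ^ 2 := by nlinarith
    nlinarith
  nlinarith [mul_pos hκ (by linarith : (0:ℝ) < 2 * n - L ^ 3)]

end CellForecastPressureDecay

end

end Summit.AtomisticToContinuum.HydrodynamicLimit.Theorems
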